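import Summits.AnomalousDissipation.AnomalousDissipation.Theorems.SawtoothPulseCascadeK1LocalisedCascadeThinJunkNumeric
import Summits.AnomalousDissipation.AnomalousDissipation.Theorems.SawtoothPulseCascadeK1LocalisedCascadeOscJunkNumeric
import Summits.AnomalousDissipation.AnomalousDissipation.Theorems.SawtoothPulseCascadeK1LocalisedCascadePhaseSums
import Summits.AnomalousDissipation.AnomalousDissipation.Theorems.SawtoothPulseCascadeK1LocalisedCascadeThinRatioBlocks

/-!
# K1loc — helper: GEOMETRIC MAJORANTS OF THE THIN-TAIL JUNK, ALL PHASES AT ONCE (numeric layer, typed tools)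

Helper file of the prover lane on the crux `K1LocalisedCascade` (stmt-AnomalousDissipation-19491), route `SawtoothPulseCascade`
(S-B/S-C assembly seat; the LEDGER ASSEMBLY, thin tail).  The closer `K1Ledger.From.k1Localised_of_resolved_ledger_geometric`
wants every junk amplitude of the tail phase `j = j₀ + i` below `(const)·θ^i`.  Along the thin tail (`…PhaseStepThin`) the window is
`K_j = 2000k_j`, `k_j = k₁₂·61^i`, the fibre count is `N_j = 2^j = N₁2^i`, the rounding targets are chosen geometric
(`η_j = η₁ρ^i`, `ε_j = ε₀/2^i`) and the block counts affine (`M_b = M₀ + μi`); then each of the five terms of the thin / oscillatory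
junk shapes (`…ThinJunkNumeric.thinJunk_le`, `…OscJunkBounds.oscJunk_le'`) decays at least like `(9/16)^i`:
`N/D ∝ (2/61)^i`, `ηΛ2^{M_b}/N ∝ (1/4)^i`, the zone product `max(1,√(2log(1/η_j)))·δ_j ≤ y₀(17/32)^i` (affine zone depth
`…PhaseSums.zoneDepth_le_affine` against `δ_j = δ₀/2^j`), the affine block count absorbed by `(1+i)x^i ≤ θ^i` (`x ≤ θ/2`) or by
`(1+i)(17/18)^i ≤ 19`.  Results (pure real arithmetic, certificates decided by `norm_num` at the call site):
* `zoneDepth_antitone`, `zoneDelta_geom_le` (the zone product along a geometric target, with `< π/2`),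
* (in the companion `…TailGeomJunk`: `sqrt_thinJunk_geom_le`, `sqrt_oscJunk_geom_le`, `√J_{j₀+i} ≤ w·(3/4)^i` from ONE
  rational certificate at `i = 0`),
* `far_geom_sq_le`, `sqrt_far_geom_le` and the block-top lower bounds `topPow_blocks_ge`, `ratio_blocks_ge` (far terms `≤ φ(3/4)^i`).
No definitions; no statement about the crux. [cite: Grafakos2014, Prop. 3.2.7 (3)] [problem: turb]
-/

-- `Summit.<Summit>.<Problem>`: single-conjunct summit, the duplicate namespace segment is deliberate.
set_option linter.dupNamespace false

noncomputable section

namespace Summit.AnomalousDissipation.AnomalousDissipation.Theorems.SawtoothPulseCascade.K1Window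

open Real
open Literature.Analysis.FluidPDE.SawtoothCascade Literature.Analysis.FluidPDE.SawtoothCascade.CascadeParams

/-! ## §1 Polynomial slack against a geometric ratio -/

/-- `(1 + i)·x^i ≤ θ^i` for `0 ≤ x ≤ θ/2` (since `1 + i ≤ 2^i`). [folklore] -/
theorem one_add_natCast_mul_pow_le_pow {x θ : ℝ} (hx : 0 ≤ x) (hxθ : x ≤ θ / 2) (i : ℕ) : (1 + (i : ℝ)) * x ^ i ≤ θ ^ i := by
  have hθ : 0 ≤ θ := by linarith
  have h1 : x ^ i ≤ (θ / 2) ^ i := pow_le_pow_left₀ hx hxθ i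
  have h2 : (1 + (i : ℝ)) ≤ 2 ^ i := by
    have h : i < 2 ^ i := Nat.lt_two_pow_self
    have h' : ((i + 1 : ℕ) : ℝ) ≤ ((2 ^ i : ℕ) : ℝ) := by exact_mod_cast Nat.succ_le_of_lt h
    push_cast at h'
    linarith
  have h3 : (0 : ℝ) ≤ 1 + i := by positivity
  calc (1 + (i : ℝ)) * x ^ i ≤ 2 ^ i * (θ / 2) ^ i := mul_le_mul h2 h1 (pow_nonneg hx i) (by positivity)
    _ = θ ^ i := by rw [← mul_pow]; congr 1; ring

/-- `(1 + i)·ρ^i ≤ 1 + 1/(1 − ρ)` for `0 ≤ ρ < 1`. [folklore] -/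
theorem one_add_natCast_mul_pow_le {ρ : ℝ} (hρ0 : 0 ≤ ρ) (hρ1 : ρ < 1) (i : ℕ) : (1 + (i : ℝ)) * ρ ^ i ≤ 1 + 1 / (1 - ρ) := by
  have h1 : ρ ^ i ≤ 1 := pow_le_one₀ hρ0 hρ1.le
  have h2 := natCast_mul_pow_le hρ0 hρ1 i
  nlinarith

/-- **Affine × halving below `(17/32)^i`**: `α, β ≥ 0` give `(α + β·i)/2^i ≤ (α + 17β)·(17/32)^i`. [folklore] -/
theorem affine_half_pow_le {α β : ℝ} (hα : 0 ≤ α) (hβ : 0 ≤ β) (i : ℕ) :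
    (α + β * i) * (1 / 2) ^ i ≤ (α + 17 * β) * (17 / 32 : ℝ) ^ i := by
  have e : ((1 : ℝ) / 2) ^ i = (16 / 17 : ℝ) ^ i * (17 / 32 : ℝ) ^ i := by rw [← mul_pow]; norm_num
  have h1 : (16 / 17 : ℝ) ^ i ≤ 1 := pow_le_one₀ (by norm_num) (by norm_num)
  have h2 : (i : ℝ) * (16 / 17 : ℝ) ^ i ≤ 17 := by
    have := natCast_mul_pow_le (ρ := (16 / 17 : ℝ)) (by norm_num) (by norm_num) i
    norm_num at this; linarith
  rw [e, ← mul_assoc]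
  refine mul_le_mul_of_nonneg_right ?_ (by positivity)
  nlinarith [mul_le_mul_of_nonneg_left h1 hα, mul_le_mul_of_nonneg_left h2 hβ]

/-! ## §2 The zone product along a geometric rounding target -/

/-- The zone depth `max(1, √(2log(1/η)))` is antitone in `η > 0`. [folklore] -/
theorem zoneDepth_antitone {η η' : ℝ} (hη : 0 < η) (h : η ≤ η') :
    max 1 (Real.sqrt (2 * Real.log (1 / η'))) ≤ max 1 (Real.sqrt (2 * Real.log (1 / η))) := by
  have hη' : 0 < η' := lt_of_lt_of_le hη h
  refine max_le_max le_rfl (Real.sqrt_le_sqrt (mul_le_mul_of_nonneg_left ?_ (by norm_num)))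
  exact Real.log_le_log (by positivity) (one_div_le_one_div_of_le hη h)

/-- `1/η ≤ 2^m`, `0 ≤ M₀`, `1.3862943616·m ≤ M₀²` give `√(2log(1/η)) ≤ M₀` (`η > 0`). [folklore] -/
theorem sqrt_two_log_le {η M₀ : ℝ} {m : ℕ} (hη : 0 < η) (h : 1 / η ≤ 2 ^ m) (hM₀ : 0 ≤ M₀) (hM : 1.3862943616 * m ≤ M₀ ^ 2) :
    Real.sqrt (2 * Real.log (1 / η)) ≤ M₀ := by
  refine Real.sqrt_le_iff.mpr ⟨hM₀, ?_⟩
  have h1 : Real.log (1 / η) ≤ Real.log (2 ^ m) := Real.log_le_log (by positivity) h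
  rw [Real.log_pow] at h1
  have h2 := Real.log_two_lt_d9
  have hm : (0 : ℝ) ≤ m := Nat.cast_nonneg m
  nlinarith [mul_le_mul_of_nonneg_left h2.le hm]

/-- **THE ZONE PRODUCT ALONG A GEOMETRIC ROUNDING TARGET**: `d = 2`, `0 ≤ δ₀ ≤ δ*`, `η ≥ η₁ρ^i` (`η₁ > 0`, `0 < ρ ≤ 1`),
`1/η₁ ≤ 2^m`, `1/ρ ≤ 2^{m′}`, `M₀² ≥ 1.3862943616·m`, `M₁² ≥ 1.3862943616·m′` (`M₀, M₁ ≥ 0`) give, at the phase `j₀ + i`,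
`0 ≤ max(1,√(2log(1/η)))·δ_{j₀+i} ≤ (1 + M₀ + 17M₁)·(δ*/2^{j₀})·(17/32)^i`. [folklore] -/
theorem zoneDelta_geom_le (P : CascadeParams) (hd : P.d = 2) {δs : ℝ} (hδ₀ : 0 ≤ P.δ₀) (hδ₀' : P.δ₀ ≤ δs)
    {η η₁ ρ M₀ M₁ : ℝ} {m m' : ℕ} (j₀ i : ℕ) (hη₁ : 0 < η₁) (hρ : 0 < ρ) (hρ1 : ρ ≤ 1) (hη : η₁ * ρ ^ i ≤ η)
    (hm : 1 / η₁ ≤ 2 ^ m) (hM₀ : 0 ≤ M₀) (hM : 1.3862943616 * m ≤ M₀ ^ 2)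
    (hm' : 1 / ρ ≤ 2 ^ m') (hM₁ : 0 ≤ M₁) (hM' : 1.3862943616 * m' ≤ M₁ ^ 2) :
    0 ≤ max 1 (Real.sqrt (2 * Real.log (1 / η))) * P.δ (j₀ + i) ∧
      max 1 (Real.sqrt (2 * Real.log (1 / η))) * P.δ (j₀ + i) ≤ (1 + M₀ + 17 * M₁) * (δs / 2 ^ j₀) * (17 / 32 : ℝ) ^ i := by
  obtain ⟨hδ0, hδle⟩ := P.delta_le_of_le hd hδ₀ hδ₀' (j₀ + i)
  have hηpos : 0 < η₁ * ρ ^ i := by positivity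
  have h1 := zoneDepth_antitone hηpos hη
  have h2 := zoneDepth_le_affine hη₁ hρ hρ1 i
  have h3 := sqrt_two_log_le hη₁ hm hM₀ hM
  have h4 := sqrt_two_log_le hρ hm' hM₁ hM'
  have hi : (0 : ℝ) ≤ i := Nat.cast_nonneg i
  have hMle : max 1 (Real.sqrt (2 * Real.log (1 / η))) ≤ 1 + M₀ + M₁ * i := by
    have := mul_le_mul_of_nonneg_right h4 hi
    linarith
  have hM0 : 0 ≤ max 1 (Real.sqrt (2 * Real.log (1 / η))) := le_trans zero_le_one (le_max_left _ _)
  refine ⟨mul_nonneg hM0 hδ0, ?_⟩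
  have hδs : 0 ≤ δs := hδ₀.trans hδ₀'
  have h5 : max 1 (Real.sqrt (2 * Real.log (1 / η))) * P.δ (j₀ + i) ≤ (1 + M₀ + M₁ * i) * (δs / 2 ^ (j₀ + i)) :=
    mul_le_mul hMle hδle hδ0 (by positivity)
  have h6 := affine_half_pow_le (α := 1 + M₀) (β := M₁) (by positivity) hM₁ i
  have e : (δs / 2 ^ (j₀ + i)) = (δs / 2 ^ j₀) * (1 / 2) ^ i := by
    rw [pow_add, one_div_pow]; field_simp
  calc max 1 (Real.sqrt (2 * Real.log (1 / η))) * P.δ (j₀ + i) ≤ (1 + M₀ + M₁ * i) * (δs / 2 ^ (j₀ + i)) := h5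
    _ = ((1 + M₀ + M₁ * i) * (1 / 2) ^ i) * (δs / 2 ^ j₀) := by rw [e]; ring
    _ ≤ ((1 + M₀ + 17 * M₁) * (17 / 32 : ℝ) ^ i) * (δs / 2 ^ j₀) := mul_le_mul_of_nonneg_right h6 (by positivity)
    _ = (1 + M₀ + 17 * M₁) * (δs / 2 ^ j₀) * (17 / 32 : ℝ) ^ i := by ring

/-- A geometric bound below its constant: `y ≤ y₀θ^i`, `0 ≤ θ ≤ 1`, `0 ≤ y₀`, `y₀ < b` give `y < b`. [folklore] -/
theorem lt_of_le_geom {y y₀ θ b : ℝ} {i : ℕ} (h : y ≤ y₀ * θ ^ i) (hθ : 0 ≤ θ) (hθ1 : θ ≤ 1) (hy₀ : 0 ≤ y₀) (hb : y₀ < b) : y < b :=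
  lt_of_le_of_lt (h.trans (mul_le_of_le_one_right hy₀ (pow_le_one₀ hθ hθ1))) hb

/-! ## §3 Far terms along the tail -/

/-- **Far energy along the tail**: `X ≥ X₀g^i > 0` (`X₀ > 0`), `81^{2t₀} ≤ φX₀²`, `81² ≤ (3/4)g²`, `e = t₀ + i` give
`((1+γ)^{2e}/X)² ≤ φ·(3/4)^i` at `γ = 8`. [folklore] -/
theorem far_geom_sq_le (P : CascadeParams) (hγ : P.γ = 8) {t₀ i e X : ℕ} {X₀ g φ : ℝ} (he : e = t₀ + i) (hX₀ : 0 < X₀)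
    (hg : 0 < g) (hX : X₀ * g ^ i ≤ (X : ℝ)) (hcert : (81 : ℝ) ^ (2 * t₀) ≤ φ * X₀ ^ 2) (hrate : (81 : ℝ) ^ 2 ≤ 3 / 4 * g ^ 2) :
    ((1 + P.γ) ^ (2 * e) / (X : ℝ)) ^ 2 ≤ φ * (3 / 4 : ℝ) ^ i := by
  have hXg : 0 < X₀ * g ^ i := by positivity
  have hXpos : (0 : ℝ) < X := lt_of_lt_of_le hXg hX
  rw [one_add_gamma_pow_two_mul P hγ, he, div_pow, ← pow_mul]
  rw [div_le_iff₀ (by positivity)]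
  have h1 : (X₀ * g ^ i) ^ 2 ≤ (X : ℝ) ^ 2 := pow_le_pow_left₀ hXg.le hX 2
  have hφ : 0 ≤ φ := by
    by_contra hneg
    have : φ * X₀ ^ 2 < 0 := mul_neg_of_neg_of_pos (not_le.mp hneg) (by positivity)
    linarith [pow_nonneg (by norm_num : (0 : ℝ) ≤ 81) (2 * t₀)]
  have h2 : ((81 : ℝ) ^ 2) ^ i ≤ (3 / 4 * g ^ 2) ^ i := pow_le_pow_left₀ (by positivity) hrate i
  calc (81 : ℝ) ^ ((t₀ + i) * 2) = 81 ^ (2 * t₀) * (81 ^ 2) ^ i := by rw [← pow_mul, ← pow_add]; congr 1; ring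
    _ ≤ (φ * X₀ ^ 2) * (3 / 4 * g ^ 2) ^ i := mul_le_mul hcert h2 (by positivity) (by positivity)
    _ = φ * (3 / 4 : ℝ) ^ i * (X₀ * g ^ i) ^ 2 := by ring
    _ ≤ φ * (3 / 4 : ℝ) ^ i * (X : ℝ) ^ 2 := mul_le_mul_of_nonneg_left h1 (by positivity)

/-- **Far amplitude along the tail**: `X ≥ X₀g^i` (`X₀, g > 0`), `81^{t₀} ≤ ψX₀`, `81 ≤ (3/4)g`, `e = t₀ + i` give
`√(((1+γ)^{2e}/X)²) ≤ ψ·(3/4)^i` at `γ = 8`. [folklore] -/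
theorem sqrt_far_geom_le (P : CascadeParams) (hγ : P.γ = 8) {t₀ i e X : ℕ} {X₀ g ψ : ℝ} (he : e = t₀ + i) (hX₀ : 0 < X₀)
    (hg : 0 < g) (hX : X₀ * g ^ i ≤ (X : ℝ)) (hcert : (81 : ℝ) ^ t₀ ≤ ψ * X₀) (hrate : (81 : ℝ) ≤ 3 / 4 * g) :
    Real.sqrt (((1 + P.γ) ^ (2 * e) / (X : ℝ)) ^ 2) ≤ ψ * (3 / 4 : ℝ) ^ i := by
  have hXg : 0 < X₀ * g ^ i := by positivity
  have hXpos : (0 : ℝ) < X := lt_of_lt_of_le hXg hX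
  rw [Real.sqrt_sq (by rw [hγ]; positivity), one_add_gamma_pow_two_mul P hγ, he, div_le_iff₀ hXpos]
  have hψ : 0 ≤ ψ := by
    by_contra hneg
    have : ψ * X₀ < 0 := mul_neg_of_neg_of_pos (not_le.mp hneg) hX₀
    linarith [pow_nonneg (by norm_num : (0 : ℝ) ≤ 81) t₀]
  have h2 : (81 : ℝ) ^ i ≤ (3 / 4 * g) ^ i := pow_le_pow_left₀ (by norm_num) hrate i
  calc (81 : ℝ) ^ (t₀ + i) = 81 ^ t₀ * 81 ^ i := pow_add _ _ _
    _ ≤ (ψ * X₀) * (3 / 4 * g) ^ i := mul_le_mul hcert h2 (by positivity) (by positivity)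
    _ = ψ * (3 / 4 : ℝ) ^ i * (X₀ * g ^ i) := by ring
    _ ≤ ψ * (3 / 4 : ℝ) ^ i * (X : ℝ) := mul_le_mul_of_nonneg_left hX (by positivity)

/-- **Top-power block tops grow like `122^i`**: `M ≥ 12`, `k = k₀·61^i` give
`(c₁k₀·2^{M−12})·122^i ≤ ((c₁k + c₂k·min(M+i, 12))·2^{(M+i)−12} : ℕ)`. [folklore] -/
theorem topPow_blocks_ge {c₁ c₂ k₀ M : ℕ} (hM : 12 ≤ M) (i : ℕ) :
    ((c₁ * k₀ * 2 ^ (M - 12) : ℕ) : ℝ) * (122 : ℝ) ^ i ≤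
      (((c₁ * (k₀ * 61 ^ i) + c₂ * (k₀ * 61 ^ i) * min (M + i) 12) * 2 ^ (M + i - 12) : ℕ) : ℝ) := by
  have e1 : M + i - 12 = (M - 12) + i := by omega
  have h : c₁ * k₀ * 2 ^ (M - 12) * 122 ^ i ≤ (c₁ * (k₀ * 61 ^ i) + c₂ * (k₀ * 61 ^ i) * min (M + i) 12) * 2 ^ (M + i - 12) := by
    rw [e1, pow_add, show (122 : ℕ) = 61 * 2 by norm_num, mul_pow]
    calc c₁ * k₀ * 2 ^ (M - 12) * (61 ^ i * 2 ^ i) = c₁ * (k₀ * 61 ^ i) * (2 ^ (M - 12) * 2 ^ i) := by ring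
      _ ≤ (c₁ * (k₀ * 61 ^ i) + c₂ * (k₀ * 61 ^ i) * min (M + i) 12) * (2 ^ (M - 12) * 2 ^ i) :=
          Nat.mul_le_mul_right _ (Nat.le_add_right _ _)
  exact_mod_cast h

/-- **Ratio block tops grow like `(61·(9/8)^μ)^i`**: `2 ≤ c·k₀` and `k = k₀·61^i`, `M_b = M + μi` give
`(ck₀/2·(9/8)^M)·(61·(9/8)^μ)^i ≤ (ck·9^{M_b}/8^{M_b} : ℕ)`. [folklore] -/
theorem ratio_blocks_ge {c k₀ M μ : ℕ} (hck : 2 ≤ c * k₀) (i : ℕ) :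
    ((c * k₀ : ℕ) : ℝ) / 2 * (9 / 8 : ℝ) ^ M * ((61 : ℝ) * (9 / 8 : ℝ) ^ μ) ^ i ≤
      ((c * (k₀ * 61 ^ i) * 9 ^ (M + μ * i) / 8 ^ (M + μ * i) : ℕ) : ℝ) := by
  have h2 : 2 ≤ c * (k₀ * 61 ^ i) := by
    calc 2 ≤ c * k₀ := hck
      _ = c * (k₀ * 61 ^ 0) := by simp
      _ ≤ c * (k₀ * 61 ^ i) := Nat.mul_le_mul_left _ (Nat.mul_le_mul_left _ (Nat.pow_le_pow_right (by norm_num) (Nat.zero_le _)))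
  have h := thinR_blocks_ge_half_geom h2 (M + μ * i)
  refine le_trans (le_of_eq ?_) h
  push_cast
  ring

end Summit.AnomalousDissipation.AnomalousDissipation.Theorems.SawtoothPulseCascade.K1Window
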